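import Mathlib

/-!
# The algebra behind the family `(A ∥ B) ∧ Y` (seat mine-b, cell pub-perc-repro2)

`capone_alg`: the nine transport hypotheses for the six flow counts of `(A ∥ B) ∧ Y` — two pieces of
capacity one in parallel, in series with an arbitrary pattern `Y` — follow from the theorems of the
grammar for `Y` (the third inequality, Harris `cM ≤ a₁²`, `a₂ ≤ c`) and the count identities. With
`u = x_A x_B`, `v = x_A z_B + z_A x_B`, `w = z_A z_B` and `n₂₀ = u a₂`, `n₁₁ = 2u c`,
`n₁₀ = v a₁ + u Q + 2u X`, `n₀₀ = w M + 2(u + v) P + 2u Z`, the key identity is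

  `n₁₀² + n₁₀ n₂₀ − n₀₀ n₁₁ = u²·[third-slack] + (x_A z_B − z_A x_B)² a₁² + 2uw(a₁² − cM) + 2uw a₁²
                              + uv·(4(a₁² − cM) + a₁(2a₁ − a₂))`.
-/

namespace Summit.Ventures.PercRepro2.Tail2D

/-- the nine hypotheses for the counts of `(A ∥ B) ∧ Y`, from the theorems of the grammar for `Y` -/
lemma capone_alg (n00 n10 n20 n11 xA xB zA zB M a₁ a₂ c Q P Z X : ℤ)
    (hxA : 0 ≤ xA) (hxB : 0 ≤ xB) (hzA : 0 ≤ zA) (hzB : 0 ≤ zB) (hM : 0 ≤ M) (ha₁ : 0 ≤ a₁) (ha₂ : 0 ≤ a₂)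
    (hc : 0 ≤ c) (hQ0 : 0 ≤ Q) (hP0 : 0 ≤ P) (hZ0 : 0 ≤ Z) (hX0 : 0 ≤ X)
    (h20 : n20 = xA * xB * a₂) (h11 : n11 = xA * xB * c + xA * xB * c)
    (h10 : n10 = (zA * xB + xA * zB) * a₁ + xA * xB * Q + (xA * xB + xA * xB) * X)
    (h00 : n00 = zA * zB * M + (zA * xB + xA * zB) * P + (zA * xB + xA * zB) * P + xA * xB * P + xA * xB * P
      + (xA * xB + xA * xB) * Z)
    (rQ : Q + a₂ = a₁) (rP : a₁ + P = M) (rZ : c + P + P = M + Z) (rX : X + c = a₁)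
    (hIII : (P + P + 2 * Z) * (2 * c) ≤ (Q + 2 * X) * (Q + 2 * X) + (Q + 2 * X) * a₂)
    (hH : c * M ≤ a₁ ^ 2) (hI : a₂ ≤ c) :
    n00 * n20 ≤ n10 * n10 + n10 * n20 ∧ n20 * n20 ≤ n11 * n11 ∧ n20 * n10 ≤ n10 * n11
      ∧ n00 * n20 ≤ n10 * n10 + n10 * n11 ∧ n00 * n11 ≤ n10 * n10 + n10 * n20 := by
  have hu : 0 ≤ xA * xB := mul_nonneg hxA hxB
  have hv : 0 ≤ zA * xB + xA * zB := by positivity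
  have hw : 0 ≤ zA * zB := mul_nonneg hzA hzB
  have hn10 : 0 ≤ n10 := by rw [h10]; positivity
  have hn00 : 0 ≤ n00 := by rw [h00]; positivity
  have hca : c ≤ a₁ := by linarith
  -- Λ
  have hΛ : n00 * n11 ≤ n10 * n10 + n10 * n20 := by
    have hX' : X = a₁ - c := by linarith
    have hQ' : Q = a₁ - a₂ := by linarith
    have hP' : P = M - a₁ := by linarith
    have hZ' : Z = c + M - 2 * a₁ := by linarith
    subst hX' hQ' hP' hZ'
    have key : n10 * n10 + n10 * n20 - n00 * n11
        = (xA * xB) ^ 2 * (((a₁ - a₂) + 2 * (a₁ - c)) * ((a₁ - a₂) + 2 * (a₁ - c)) + ((a₁ - a₂) + 2 * (a₁ - c)) * a₂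
            - ((M - a₁) + (M - a₁) + 2 * (c + M - 2 * a₁)) * (2 * c))
          + (xA * zB - zA * xB) ^ 2 * a₁ ^ 2 + 2 * (xA * xB) * (zA * zB) * (a₁ ^ 2 - c * M)
          + 2 * (xA * xB) * (zA * zB) * a₁ ^ 2
          + (xA * xB) * (zA * xB + xA * zB) * (4 * (a₁ ^ 2 - c * M) + a₁ * (2 * a₁ - a₂)) := by
      rw [h20, h11, h10, h00]; ring
    have t1 : 0 ≤ (xA * xB) ^ 2 * (((a₁ - a₂) + 2 * (a₁ - c)) * ((a₁ - a₂) + 2 * (a₁ - c)) + ((a₁ - a₂) + 2 * (a₁ - c)) * a₂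
        - ((M - a₁) + (M - a₁) + 2 * (c + M - 2 * a₁)) * (2 * c)) :=
      mul_nonneg (sq_nonneg _) (by linarith)
    have t2 : 0 ≤ (xA * zB - zA * xB) ^ 2 * a₁ ^ 2 := by positivity
    have t3 : 0 ≤ 2 * (xA * xB) * (zA * zB) * (a₁ ^ 2 - c * M) :=
      mul_nonneg (mul_nonneg (mul_nonneg (by norm_num) hu) hw) (by linarith)
    have t4 : 0 ≤ 2 * (xA * xB) * (zA * zB) * a₁ ^ 2 := by positivity
    have t5 : 0 ≤ (xA * xB) * (zA * xB + xA * zB) * (4 * (a₁ ^ 2 - c * M) + a₁ * (2 * a₁ - a₂)) :=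
      mul_nonneg (mul_nonneg hu hv) (by nlinarith [mul_nonneg ha₁ (by linarith : (0 : ℤ) ≤ 2 * a₁ - a₂)])
    linarith [key, t1, t2, t3, t4, t5]
  have h2011 : n20 ≤ n11 := by rw [h20, h11]; nlinarith [mul_le_mul_of_nonneg_left hI hu]
  have hn20 : 0 ≤ n20 := by rw [h20]; positivity
  refine ⟨?_, ?_, ?_, ?_, hΛ⟩
  · -- R2
    have := mul_le_mul_of_nonneg_left h2011 hn00
    linarith
  · -- S
    have := mul_le_mul h2011 h2011 hn20 (by rw [h11]; positivity)
    linarith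
  · -- E
    have := mul_le_mul_of_nonneg_left h2011 hn10
    linarith
  · -- R1
    have e1 := mul_le_mul_of_nonneg_left h2011 hn00
    have e2 := mul_le_mul_of_nonneg_left h2011 hn10
    linarith

end Summit.Ventures.PercRepro2.Tail2D
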